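/-
Copyright (c) 2026 the pub-hodgecm-mathlib formalisation cell (harness21).  Prover seat hodgecm-mathlib-K2Liu-p13 (g4), Track B «K2-LIT»,
#184♮ = hLiu418 = `stmt-HodgeConjecture-24832`; ROAD Φ (RULING «M-156n»), #41 TOP editions 5–8 (★ K2E5-p17 (g8)) — the KIND-0 big-cell CONTINUATION LETTER
`(E, hEd, hEeq)` FROM ITS FACES, in ONE name: ★ `K2LiuBigCellContinuationReduction` (all `x` ← points of `K`) ∘ ★ `K2LiuBigCellContinuationPointLetters`
(point assembly, A7-AllS0 currency bridge) ∘ ★ `K2LiuSiegelIntertwiningScalarChangeOfSet` (the TOP's scalar `b^{S_ε}∕a^{S_ε}` at the Euler head's larger set),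
and the big-cell TERM PACKAGE of ★ `exists_bigCell_termPackage_cm'` with that letter discharged down to the faces.
THEOREMS ONLY (no `def`, no `instance`, no named-fact hypothesis, no `sorry`).
-/
import Summits.HodgeConjecture.HodgeConjecture.Theorems.K2LiuBigCellContinuationReduction          -- ★ p861688 `exists_continuation_of_isStandardSectionFamily_pointwise`
import Summits.HodgeConjecture.HodgeConjecture.Theorems.K2LiuBigCellContinuationPointLetters       -- ★ p861729 `exists_pointContinuation_of_faces`
import Summits.HodgeConjecture.HodgeConjecture.Theorems.K2LiuSiegelIntertwiningScalarChangeOfSet  -- ★ p861784 `invScalar_eq_finsetProd_mul_cm`, `differentiableOn_finsetProd_inv_localScalar_cm`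
import Summits.HodgeConjecture.HodgeConjecture.Theorems.K2LiuSiegelEisensteinBigCellTermPackageCM  -- ★ p861474 `exists_bigCell_termPackage_cm'`
import HarnessLib

/-!
# Crux `HLiu418`, ROAD Φ, organ Φ8 (row G6): THE BIG-CELL CONTINUATION LETTER `(E, hEd, hEeq)` FROM ITS FACES — one name for the #41 TOP

Cell `hodgecm-mathlib`, crux item hLiu418 = `stmt-HodgeConjecture-24832` (helper lane, count-neutral).  Doubled frame `H(𝔸) = HA L e dV hdV dW hdW`, Iwasawa datum `𝒦`,
Haar `νN` on `N_Δ(𝔸)`, `M(s)f_s = intertwiningDelta νN (f s)`.  The #41 TOP (★ editions 5–8, `siegelEisensteinContinuation_assembled` …) takes BY VALUE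
`(E) (hEd : ∀ x, DifferentiableOn ℂ (E · x) {0<re}) (hEeq : ∀ s x, n∕2 < re s → E s x = a s * intertwiningDelta νN (f s) x)`.
THIS FILE states that letter's SUPPLIER over the faces of the Euler computation, per point `κ ∈ K` (every local component of `κ` lies in `K_v`, so the Euler head
★ Φ3d `whittakerDelta_eq_mul_tprod` at index `0` needs no side condition there):
* §1 **`exists_bigCell_continuation_of_faces`** (generic `n`, any scalar `a`, any `χ`; only `hstd`): for every `κ ∈ K` an abstract finite index `TF κ` of bad finite places
  with residue characteristics `q v ≠ 0`, an archimedean block `A κ` holomorphic on `{0<re}`, explicit local scalars `c κ v` holomorphic on `{0<re}`, normalised local values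
  `N κ v` with A7-AllS0's clause `∀ s₀, 0 < re s₀ → IsQRationalRegularAt (q v) s₀ (N κ v)` VERBATIM, and the EULER-FACE IDENTITY
  `a s · M(s)f_s(κ) = A κ s · ∏_{v∈TF κ} (c κ v s · N κ v s)` on `re s > n∕2` ⟹ `(E, hEd, hEeq)`.
* §2 **`exists_bigCell_continuation_cm_of_faces`** (K2_Liu frame `n = 2`, `a := b^S∕a^S` of ★ `exists_bigCell_termPackage_cm`, `S` = the `ε_{L∕L⁺}`-exceptional set of
  the TOP): the Euler-face identity may be given at ANY LARGER exceptional set `S ∪ P κ` (`P κ` finite, disjoint from `S` — e.g. the ramification of `f` and the places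
  where `κ_v ∉ K_{H,v}`): `(b^{S∪Pκ}∕a^{S∪Pκ})(s) · M(s)f_s(κ) = A κ s · ∏ (c κ v s · N κ v s)` on `re s > 1` ⟹ the letter for `a = b^S∕a^S`
  (★ `invScalar_eq_finsetProd_mul_cm` moves the set; the finite correction `∏_{v∈Pκ} c_v⁻¹` is holomorphic on `{0<re}`, ★ `differentiableOn_finsetProd_inv_localScalar_cm`).
* §3 **`exists_bigCell_termPackage_cm_of_faces`** — ★ `exists_bigCell_termPackage_cm'` (the TOP's kind-0 big-cell term package `Ec₈`, `P₈ = {½}`) with its one by-value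
  letter `(E, hEd, hEeq)` DISCHARGED down to the faces of §2.
WHAT REMAINS BY VALUE after this file (named, per `κ ∈ K`): the Euler-face identity itself (★ Φ3d + the pure-tensor split of its `T`-block + Gindikin–Karpelevich's
spherical value `c_v` off `T` + ★ A7-AllS0 per bad place, junction `aNorm_v = vol_v·c_v`), and the holomorphy of the archimedean block `A κ` (σ20 ladder, K2Liu-p11).
Sources: [Tan1999, §3]; [KudlaSweet1997, §1]; [HarrisKudlaSweet1996, §6 (6.14)–(6.16)]; [Garrett2018, §3.10–§3.12]; [MoeglinWaldspurger1995, II.1.7, IV.1.8].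
HONEST LABEL.  Helper lemmas, count-neutral; `HC_CM` is proved only modulo the 7 printed citations (2 remaining named inputs:
hLiu418 = `stmt-HodgeConjecture-24832`, h413 = `stmt-HodgeConjecture-24833`) until rung 0 closes.
-/

set_option autoImplicit false
set_option linter.dupNamespace false -- the mandated namespace repeats `HodgeConjecture.HodgeConjecture`

noncomputable section

open scoped Matrix NNReal ENNReal
open NumberField IsDedekindDomain MeasureTheory MeasureTheory.Measure Metric

namespace Summit.HodgeConjecture.HodgeConjecture.Cruxes.HLiu418.K2LiuBigCellContinuationOfFaces

open Literature.NumberTheory.GelbartRogawski1991.AdaptedBlocks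
open Literature.NumberTheory.Automorphic Literature.NumberTheory.Automorphic.UnitaryGroup
open Literature.NumberTheory.GelbartRogawski1991 Literature.NumberTheory.GelbartRogawski1991.GRConstruction
open Literature.NumberTheory.K2Lit.SiegelDoubled Literature.NumberTheory.GaloisRepresentations Literature.NumberTheory.LFunctions
open UnitaryDualPair
open Summit.HodgeConjecture.HodgeConjecture.Cruxes.HLiu418.K2LiuQRationalDefs (IsQRationalRegularAt)
open Summit.HodgeConjecture.HodgeConjecture.Cruxes.HLiu418.K2LiuBigCellContinuationReduction (exists_continuation_of_isStandardSectionFamily_pointwise)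
open Summit.HodgeConjecture.HodgeConjecture.Cruxes.HLiu418.K2LiuBigCellContinuationPointLetters (exists_pointContinuation_of_faces)
open Summit.HodgeConjecture.HodgeConjecture.Cruxes.HLiu418.K2LiuSiegelIntertwiningScalarChangeOfSet
  (invScalar_eq_finsetProd_mul_cm differentiableOn_finsetProd_inv_localScalar_cm)
open Summit.HodgeConjecture.HodgeConjecture.Cruxes.HLiu418.K2LiuSiegelEisensteinBigCellTermPackageCM (exists_bigCell_termPackage_cm')

variable (L : Type) [Field L] [NumberField L] [IsCMField L]
variable {N M n : ℕ} (e : Fin N × Fin M ≃ Fin n)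
  (dV : Fin N → L) (hdV : ∀ i, IsCMField.complexConj L (dV i) = dV i)
  (dW : Fin M → L) (hdW : ∀ i, IsCMField.complexConj L (dW i) = dW i)

/-! ## §1 Generic scalar: the letter from the Euler faces at the points of `K` -/

/-- **THE BIG-CELL CONTINUATION LETTER FROM ITS FACES** (generic `n`, any scalar `a`, any `χ`).  For a standard family `f` and, at every `κ ∈ K`: a finite index `TF κ` of bad
finite places (`q v ≠ 0`), an archimedean block `A κ` and local scalars `c κ v` holomorphic on `{0<re}`, normalised local values `N κ v` `q_v`-rational regular at every
`s₀` with `0 < re s₀`, and the Euler-face identity `a s · M(s)f_s(κ) = A κ s · ∏_{v∈TF κ}(c κ v s · N κ v s)` on `re s > c₀` — THEN `∃ E`, holomorphic on `{0<re}` in `s` for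
every `x ∈ H(𝔸)`, with `E s x = a s · M(s)f_s(x)` on `re s > c₀`. [cite: Tan1999, §3] [cite: KudlaSweet1997, §1] [cite: Garrett2018, §3.10–§3.12] -/
theorem exists_bigCell_continuation_of_faces (hdV0 : ∀ i, dV i ≠ 0) (hdW0 : ∀ i, dW i ≠ 0) (𝒦 : IwasawaDatum L e dV hdV dW hdW)
    [MeasurableSpace (unipDelta L e dV hdV dW hdW)] [BorelSpace (unipDelta L e dV hdV dW hdW)]
    (νN : Measure (unipDelta L e dV hdV dW hdW)) [νN.IsHaarMeasure] (χ : HeckeCharacter L) (c₀ : ℝ)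
    {f : ℂ → HA L e dV hdV dW hdW → ℂ} (hstd : IsStandardSectionFamily 𝒦 χ f) (a : ℂ → ℂ)
    {ι : Type*} (TF : ↥𝒦.K → Finset ι) (q : ι → ℕ) (hq : ∀ κ, ∀ v ∈ TF κ, q v ≠ 0)
    (A : ↥𝒦.K → ℂ → ℂ) (hA : ∀ κ, DifferentiableOn ℂ (A κ) {s : ℂ | 0 < s.re})
    (c N : ↥𝒦.K → ι → ℂ → ℂ) (hc : ∀ κ, ∀ v ∈ TF κ, DifferentiableOn ℂ (c κ v) {s : ℂ | 0 < s.re})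
    (hN : ∀ κ, ∀ v ∈ TF κ, ∀ s₀ : ℂ, 0 < s₀.re → IsQRationalRegularAt (q v) s₀ (N κ v))
    (hB : ∀ (κ : ↥𝒦.K) (s : ℂ), c₀ < s.re →
      a s * intertwiningDelta L e dV hdV dW hdW νN (f s) (κ : HA L e dV hdV dW hdW) = A κ s * ∏ v ∈ TF κ, (c κ v s * N κ v s)) :
    ∃ E : ℂ → HA L e dV hdV dW hdW → ℂ,
      (∀ x : HA L e dV hdV dW hdW, DifferentiableOn ℂ (fun s : ℂ => E s x) {s : ℂ | 0 < s.re}) ∧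
      (∀ (s : ℂ) (x : HA L e dV hdV dW hdW), c₀ < s.re → E s x = a s * intertwiningDelta L e dV hdV dW hdW νN (f s) x) :=
  exists_continuation_of_isStandardSectionFamily_pointwise L e dV hdV dW hdW hdV0 hdW0 𝒦 νN χ c₀ hstd a fun k hk =>
    exists_pointContinuation_of_faces (TF ⟨k, hk⟩) q (hq ⟨k, hk⟩) c₀ (A ⟨k, hk⟩) (hA ⟨k, hk⟩) (c ⟨k, hk⟩) (N ⟨k, hk⟩) (hc ⟨k, hk⟩) (hN ⟨k, hk⟩)
      (fun s => a s * intertwiningDelta L e dV hdV dW hdW νN (f s) k) (hB ⟨k, hk⟩)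

/-! ## §2 The K2_Liu frame: `a = b^S∕a^S`, faces at a larger exceptional set `S ∪ P κ` -/

/-- **THE BIG-CELL CONTINUATION LETTER OF THE #41 TOP AT THE K2_Liu FRAME, FROM ITS FACES** (`n = 2`, scalar `a := b^S∕a^S` with `ε = ε_{L∕L⁺}`, as in ★
`exists_bigCell_termPackage_cm`).  Per `κ ∈ K` the Euler-face identity may be supplied at any larger exceptional set `S ∪ P κ` (`P κ` finite, disjoint from `S`):
`(b^{S∪Pκ}∕a^{S∪Pκ})(s) · M(s)f_s(κ) = A κ s · ∏_{v∈TF κ}(c κ v s · N κ v s)` on `re s > 1` — THEN `(E, hEd, hEeq)` for `a = b^S∕a^S` in the TOP's bytes.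
[cite: Tan1999, §3] [cite: KudlaSweet1997, §1] [cite: HarrisKudlaSweet1996, §6 (6.14)–(6.16)] -/
theorem exists_bigCell_continuation_cm_of_faces (hn : n = 2) (hdV0 : ∀ i, dV i ≠ 0) (hdW0 : ∀ i, dW i ≠ 0) (𝒦 : IwasawaDatum L e dV hdV dW hdW)
    [MeasurableSpace (unipDelta L e dV hdV dW hdW)] [BorelSpace (unipDelta L e dV hdV dW hdW)]
    (νN : Measure (unipDelta L e dV hdV dW hdW)) [νN.IsHaarMeasure] (χ : HeckeCharacter L)
    {f : ℂ → HA L e dV hdV dW hdW → ℂ} (hstd : IsStandardSectionFamily 𝒦 χ f)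
    (S : Set (HeightOneSpectrum (𝓞 ↥(maximalRealSubfield L))))
    (P : ↥𝒦.K → Finset (HeightOneSpectrum (𝓞 ↥(maximalRealSubfield L)))) (hPS : ∀ κ, ∀ v ∈ P κ, v ∉ S)
    {ι : Type*} (TF : ↥𝒦.K → Finset ι) (q : ι → ℕ) (hq : ∀ κ, ∀ v ∈ TF κ, q v ≠ 0)
    (A : ↥𝒦.K → ℂ → ℂ) (hA : ∀ κ, DifferentiableOn ℂ (A κ) {s : ℂ | 0 < s.re})
    (c N : ↥𝒦.K → ι → ℂ → ℂ) (hc : ∀ κ, ∀ v ∈ TF κ, DifferentiableOn ℂ (c κ v) {s : ℂ | 0 < s.re})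
    (hN : ∀ κ, ∀ v ∈ TF κ, ∀ s₀ : ℂ, 0 < s₀.re → IsQRationalRegularAt (q v) s₀ (N κ v))
    (hB : ∀ (κ : ↥𝒦.K) (s : ℂ), 1 < s.re →
      (partialStandardL (S ∪ (↑(P κ) : Set (HeightOneSpectrum (𝓞 ↥(maximalRealSubfield L))))) (fun _ => {1}) (2 * s + 1) *
            partialStandardL (S ∪ (↑(P κ) : Set (HeightOneSpectrum (𝓞 ↥(maximalRealSubfield L))))) (fun v => {(quadraticHeckeCharCM L).valueAtUniformizer v}) (2 * s + 2)) /
          (partialStandardL (S ∪ (↑(P κ) : Set (HeightOneSpectrum (𝓞 ↥(maximalRealSubfield L))))) (fun _ => {1}) (2 * s) *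
            partialStandardL (S ∪ (↑(P κ) : Set (HeightOneSpectrum (𝓞 ↥(maximalRealSubfield L))))) (fun v => {(quadraticHeckeCharCM L).valueAtUniformizer v}) (2 * s - 1)) *
        intertwiningDelta L e dV hdV dW hdW νN (f s) (κ : HA L e dV hdV dW hdW) = A κ s * ∏ v ∈ TF κ, (c κ v s * N κ v s)) :
    ∃ E : ℂ → HA L e dV hdV dW hdW → ℂ,
      (∀ x : HA L e dV hdV dW hdW, DifferentiableOn ℂ (fun s : ℂ => E s x) {s : ℂ | 0 < s.re}) ∧
      (∀ (s : ℂ) (x : HA L e dV hdV dW hdW), (n : ℝ) / 2 < s.re →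
        E s x = (partialStandardL S (fun _ => {1}) (2 * s + 1) * partialStandardL S (fun v => {(quadraticHeckeCharCM L).valueAtUniformizer v}) (2 * s + 2)) /
            (partialStandardL S (fun _ => {1}) (2 * s) * partialStandardL S (fun v => {(quadraticHeckeCharCM L).valueAtUniformizer v}) (2 * s - 1)) *
          intertwiningDelta L e dV hdV dW hdW νN (f s) x) := by
  have hn2 : (n : ℝ) / 2 = 1 := by rw [hn]; norm_num
  refine exists_bigCell_continuation_of_faces L e dV hdV dW hdW hdV0 hdW0 𝒦 νN χ ((n : ℝ) / 2) hstd _ TF q hq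
    (fun κ s => (∏ v ∈ P κ, (((1 - (v.residueCard : ℂ) ^ (-(2 * s))) * (1 - (quadraticHeckeCharCM L).valueAtUniformizer v * (v.residueCard : ℂ) ^ (-(2 * s - 1)))) /
        ((1 - (v.residueCard : ℂ) ^ (-(2 * s + 1))) * (1 - (quadraticHeckeCharCM L).valueAtUniformizer v * (v.residueCard : ℂ) ^ (-(2 * s + 2)))))) * A κ s)
    (fun κ => ((differentiableOn_finsetProd_inv_localScalar_cm L (P κ)).mono fun s (hs : 0 < s.re) => ?_).mul (hA κ)) c N hc hN fun κ s hs => ?_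
  · show -(1 / 2 : ℝ) < s.re
    linarith
  · have hs1 : 1 < s.re := by rw [hn2] at hs; exact hs
    rw [invScalar_eq_finsetProd_mul_cm L S (P κ) (hPS κ) hs1, mul_assoc, hB κ s hs1, ← mul_assoc]

/-! ## §3 The TOP's kind-0 big-cell term package from the faces -/

/-- **THE BIG-CELL TERM PACKAGE OF THE #41 TOP AT THE K2_Liu FRAME, FROM THE FACES** — ★ `exists_bigCell_termPackage_cm'` (`P₈ = {½}`: `Ec₈` holomorphic on `{0<re}` per
`h`, continuous in `h`, `= (s − ½)·M(s)f_s(h)` on `re s > 1`, of moderate growth) with its by-value letter `(E, hEd, hEeq)` discharged by §2.  By value remain, per `κ ∈ K`: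
the Euler-face identity at `S ∪ P κ`, the archimedean block's holomorphy, A7-AllS0 per bad place.
[cite: Tan1999, §3] [cite: KudlaSweet1997, §1] [cite: Harris2007, (1.3.4) p. 92] [cite: Garrett2018, §3.12] -/
theorem exists_bigCell_termPackage_cm_of_faces (hn : n = 2) (hdV0 : ∀ i, dV i ≠ 0) (hdW0 : ∀ i, dW i ≠ 0) (𝒦 : IwasawaDatum L e dV hdV dW hdW)
    [MeasurableSpace (unipDelta L e dV hdV dW hdW)] [BorelSpace (unipDelta L e dV hdV dW hdW)]
    (νN : Measure (unipDelta L e dV hdV dW hdW)) [νN.IsHaarMeasure] (χ : HeckeCharacter L) (hχ : χ.IsUnitary)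
    (f : ℂ → HA L e dV hdV dW hdW → ℂ) (hstd : IsStandardSectionFamily 𝒦 χ f) (hcont : ∀ s, Continuous (f s))
    {S : Set (HeightOneSpectrum (𝓞 ↥(maximalRealSubfield L)))} (hS : S.Finite) (hur : ∀ v ∉ S, (quadraticHeckeCharCM L).IsUnramifiedAt v)
    (P : ↥𝒦.K → Finset (HeightOneSpectrum (𝓞 ↥(maximalRealSubfield L)))) (hPS : ∀ κ, ∀ v ∈ P κ, v ∉ S)
    {ι : Type*} (TF : ↥𝒦.K → Finset ι) (q : ι → ℕ) (hq : ∀ κ, ∀ v ∈ TF κ, q v ≠ 0)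
    (A : ↥𝒦.K → ℂ → ℂ) (hA : ∀ κ, DifferentiableOn ℂ (A κ) {s : ℂ | 0 < s.re})
    (c N : ↥𝒦.K → ι → ℂ → ℂ) (hc : ∀ κ, ∀ v ∈ TF κ, DifferentiableOn ℂ (c κ v) {s : ℂ | 0 < s.re})
    (hN : ∀ κ, ∀ v ∈ TF κ, ∀ s₀ : ℂ, 0 < s₀.re → IsQRationalRegularAt (q v) s₀ (N κ v))
    (hB : ∀ (κ : ↥𝒦.K) (s : ℂ), 1 < s.re →
      (partialStandardL (S ∪ (↑(P κ) : Set (HeightOneSpectrum (𝓞 ↥(maximalRealSubfield L))))) (fun _ => {1}) (2 * s + 1) *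
            partialStandardL (S ∪ (↑(P κ) : Set (HeightOneSpectrum (𝓞 ↥(maximalRealSubfield L))))) (fun v => {(quadraticHeckeCharCM L).valueAtUniformizer v}) (2 * s + 2)) /
          (partialStandardL (S ∪ (↑(P κ) : Set (HeightOneSpectrum (𝓞 ↥(maximalRealSubfield L))))) (fun _ => {1}) (2 * s) *
            partialStandardL (S ∪ (↑(P κ) : Set (HeightOneSpectrum (𝓞 ↥(maximalRealSubfield L))))) (fun v => {(quadraticHeckeCharCM L).valueAtUniformizer v}) (2 * s - 1)) *
        intertwiningDelta L e dV hdV dW hdW νN (f s) (κ : HA L e dV hdV dW hdW) = A κ s * ∏ v ∈ TF κ, (c κ v s * N κ v s)) :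
    ∃ Ec₈ : ℂ → HA L e dV hdV dW hdW → ℂ,
      (∀ h : HA L e dV hdV dW hdW, DifferentiableOn ℂ (fun s => Ec₈ s h) {s : ℂ | 0 < s.re}) ∧
      (∀ s : ℂ, 0 < s.re → Continuous (Ec₈ s)) ∧
      (∀ (s : ℂ) (h : HA L e dV hdV dW hdW), (n : ℝ) / 2 < s.re →
        Ec₈ s h = (s - 1 / 2) * intertwiningDelta L e dV hdV dW hdW νN (f s) h) ∧
      (∀ z : ℂ, 0 < z.re → ∃ C A ρ : ℝ, 0 < ρ ∧ ∀ s : ℂ, dist s z < ρ → ∀ h : HA L e dV hdV dW hdW,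
        ‖Ec₈ s h‖ ≤ C * adelicHeightGL (n + n) L (h : GL (Fin (n + n)) (AdeleRing (𝓞 L) L)) ^ A) := by
  obtain ⟨E, hEd, hEeq⟩ := exists_bigCell_continuation_cm_of_faces L e dV hdV dW hdW hn hdV0 hdW0 𝒦 νN χ hstd S P hPS TF q hq A hA c N hc hN hB
  exact exists_bigCell_termPackage_cm' L e dV hdV dW hdW hn hdV0 hdW0 𝒦 νN χ hχ f hstd hcont hS hur E hEd hEeq

end Summit.HodgeConjecture.HodgeConjecture.Cruxes.HLiu418.K2LiuBigCellContinuationOfFaces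

end
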